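import Summits.AtomisticToContinuum.FouriersLaw.Theses.MatthiessenLadder
import Summits.AtomisticToContinuum.FouriersLaw.Theses.TransferKernelPositivity
import Summits.AtomisticToContinuum.FouriersLaw.Theorems.OddSectorIrreversibilityBoundedResponseConvergesSplit

/-!
# Split-glue certification (crux-strategist s2, stmt-AtomisticToContinuum-9141)

The gate renders the children of `route edit --split BoundedResponseConverges --into children.json` as NEW defs in the
route namespace with the verbatim statements of stmt-12238 / stmt-11749. This scratch file emulates that for the two
routes whose Theses file is NOT in the import closure of the landed glue theorem
`Summit.AtomisticToContinuum.FouriersLaw.Theorems.boundedResponseConverges_of_subs` (p137843) — `MatthiessenLadder` and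
`TransferKernelPositivity` — and checks that `--glue-by` typechecks by definitional unfolding (children and parent are
syntactic twins of `BoundaryEscapeDeficit.EscapeNonOscillation`, `JunctionLocality.ConductanceLowerBound`,
`OddSectorIrreversibility.BoundedResponseConverges`).
-/

open scoped BigOperators Topology Classical MeasureTheory ProbabilityTheory
open Filter Set Function MeasureTheory

namespace Summit.AtomisticToContinuum.FouriersLaw.Cruxes.BoundedResponseConverges.SplitCertS2

/-- verbatim ledger signature of stmt-AtomisticToContinuum-12238 -/
def EscapeNonOscillation : Prop :=
  ∀ ω₂ lam β γ : ℝ, 0 < ω₂ → 0 < lam → 0 < β → 0 < γ → ∀ T : ℝ, 0 < T → (let P := Literature.MathematicalPhysics.KineticTheory.HeatConduction.pinnedChain ω₂ lam β γ; let K : ℕ → ℝ → ℝ := fun N u => if h : 0 < N then ∫ z, ((z.2 ⟨0, h⟩) ^ 2 - T) * (∫ y, ((y.2 ⟨0, h⟩) ^ 2 - T) ∂(P.transitionKernel N T T u.toNNReal z)) ∂(P.gibbsMeasure N T) else 0; let E : ℕ → ℝ := fun N => 1 - γ / T ^ 2 * ∫ u in Set.Ioi (0 : ℝ), K N u; ∃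 ℓ : EReal, Filter.Tendsto (fun N : ℕ => ((((N : ℝ) - 1) * γ * E N : ℝ) : EReal)) Filter.atTop (nhds ℓ))

/-- verbatim ledger signature of stmt-AtomisticToContinuum-11749 -/
def ConductanceLowerBound : Prop :=
  ∀ ω₂ lam β γ : ℝ, 0 < ω₂ → 0 < lam → 0 < β → 0 < γ → (∀ (N : ℕ) (T_L T_R : ℝ), 0 < T_L → 0 < T_R → ∀ μ ν : MeasureTheory.Measure (Literature.MathematicalPhysics.KineticTheory.HeatConduction.PhaseSpace N), (Literature.MathematicalPhysics.KineticTheory.HeatConduction.pinnedChain ω₂ lam β γ).IsSteadyState N T_L T_R μ → (Literature.MathematicalPhysics.KineticTheory.HeatConduction.pinnedChain ω₂ lam β γ).IsSteadyState N T_L T_R ν → μ = ν) → ∀ μ : (N : ℕ) → ℝ → ℝ → MeasureTheory.Measure (Literature.MathematicalPhysics.KineticTheory.HeatConduction.PhaseSpace N), (∀ (N : ℕ) (T_L T_R : ℝ), 0 < T_L → 0 < T_R → (Literature.MathematicalPhysics.KineticTheory.HeatConduction.pinnedChain ω₂ lam β γ).IsSteadyState N T_L T_R (μ N T_L T_R))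 → ∀ T : ℝ, 0 < T → ∀ D : ℕ → ℝ, (∀ N : ℕ, Filter.Tendsto (fun δ : ℝ => (Literature.MathematicalPhysics.KineticTheory.HeatConduction.pinnedChain ω₂ lam β γ).totalCurrent (μ N (T + δ / 2) (T - δ / 2)) / δ) (nhdsWithin 0 {(0 : ℝ)}ᶜ) (nhds (D N))) → ∃ c : ℝ, 0 < c ∧ ∃ N₁ : ℕ, ∀ N : ℕ, N₁ ≤ N → c ≤ D N

/-- the rendered children are definitionally the glue theorem's hypotheses -/
example : EscapeNonOscillation ↔ Summit.AtomisticToContinuum.FouriersLaw.Theses.BoundaryEscapeDeficit.EscapeNonOscillation := Iff.rfl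
example : ConductanceLowerBound ↔ Summit.AtomisticToContinuum.FouriersLaw.Theses.JunctionLocality.ConductanceLowerBound := Iff.rfl

/-- `--glue-by` on route MatthiessenLadder: the landed theorem has the rendered type up to δ-unfolding. -/
theorem glueBy_matthiessenLadder :
    EscapeNonOscillation → ConductanceLowerBound →
      Summit.AtomisticToContinuum.FouriersLaw.Theses.MatthiessenLadder.BoundedResponseConverges :=
  Summit.AtomisticToContinuum.FouriersLaw.Theorems.boundedResponseConverges_of_subs

/-- `--glue-by` on route TransferKernelPositivity. -/
theorem glueBy_transferKernelPositivity :
    EscapeNonOscillation → ConductanceLowerBound →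
      Summit.AtomisticToContinuum.FouriersLaw.Theses.TransferKernelPositivity.BoundedResponseConverges :=
  Summit.AtomisticToContinuum.FouriersLaw.Theorems.boundedResponseConverges_of_subs

/-- the parents are twins of the glue theorem's conclusion -/
example : Summit.AtomisticToContinuum.FouriersLaw.Theses.MatthiessenLadder.BoundedResponseConverges ↔
    Summit.AtomisticToContinuum.FouriersLaw.Theses.OddSectorIrreversibility.BoundedResponseConverges := Iff.rfl
example : Summit.AtomisticToContinuum.FouriersLaw.Theses.TransferKernelPositivity.BoundedResponseConverges ↔
    Summit.AtomisticToContinuum.FouriersLaw.Theses.OddSectorIrreversibility.BoundedResponseConverges := Iff.rfl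

end Summit.AtomisticToContinuum.FouriersLaw.Cruxes.BoundedResponseConverges.SplitCertS2
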